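import Summits.HodgeConjecture.HodgeConjecture.Theorems.F0P3cStCharTSPs2Kind3             -- ★ p851400 (this seat): `isConstituentOf_iff_of_eq`, `isConstituentOf_iff_weyl`; brings ★ CUSP-SUPPORT §1 `hasJacquetExponent_of_injective_comp_equiv`, ★ N1∕N2∕N3 holds, ★ K1w
import Summits.HodgeConjecture.HodgeConjecture.Theorems.F0P2pCmPrincipalSeriesInterface   -- ★ `isSmooth_cmPrincipalSeries`
import Summits.HodgeConjecture.HodgeConjecture.Theorems.F0P3UnipotentLimitCompactOpen      -- ★ `isLimitOfCompactOpen_cmUnipotentU` (the exactness hypothesis)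
import Literature.NumberTheory.Automorphic.JacquetLineExponents                            -- ★ `HasJacquetExponent.map_of_injective`, `HasJacquetExponent.eq_or_eq_of_line`
import Literature.NumberTheory.Automorphic.JacquetModuleExactProofs                        -- ★ `Representation.jacquetMap_injective` (left exactness of the Jacquet functor)
import HarnessLib

/-!
# F0 · P3c · line LH6 «StCharTS» — brick «ORBIT★» (datum road, S7, road rule §2.5 «W-orbits»): TWO PRINCIPAL SERIES OF `U(Φ₃)(L⁺_v)` WITH A COMMON CONSTITUENT
# HAVE THE SAME SET OF CONSTITUENTS — the inducing datum of a class is a `W`-ORBIT `{χ, wχ}`  (`v` non-split)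

Cell `hodgecm-mathlib`, crux `H413` (`stmt-HodgeConjecture-24833`), line LH6 `Cruxes/H413/Lines/F0_P3c_StCharTSPaydown.lean` (organ (S-𝔇) `stub_EllipticPackage`, PAIR block:
the ∃-witness `par` must be chosen on `W`-ORBITS — MAP-DATUM-ROAD v4 §2.5 (LH6-p01 (g4)) — so that (PS3) «`par π″ = par π′` for l.d.s. mates» and (UNIQ-PAR) are dischargeable
at the SAME `par` as (PS1)(NONL2-PAR)).  Seat LH6-p03 (g4); THEOREMS ONLY (no `def`, no named fact, no `instance`, no notation, no `sorry`; axioms ⊆ {propext,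
Classical.choice, Quot.sound}); `--supports stmt-HodgeConjecture-24833`.  This file is the well-definedness input of «PAR-FIELD-W★» (the `W`-normalised `par`) and the
core of (UNIQ-PAR).  HONEST LABEL: HC_CM is proved only modulo the 7 printed citations (2 remaining: hLiu418 = stmt-HodgeConjecture-24832, h413 =
stmt-HodgeConjecture-24833) until rung 0 closes; count-neutral.

THE MATHEMATICS ([Rogawski1990, §12.2 p. 173 «`i_G(χ)` and `i_G(wχ)` have the same sets of constituents»]; [BernsteinZelevinsky1977, Thm. 2.9, §2.3, Prop. 1.9 (a)];
[Casselman1995, Cor. 6.3.9 (b), L. 7.1.1 (a), Prop. 3.2.3]).  Let `c` be a class of `G = U(Φ₃)(L⁺_v)` which is a constituent of `i_G(χ)` AND of `i_G(χ′)` (continuous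
pairs `χ = (χ₁, χ₂)`, `χ′`).  ★ N2 (Casselman 6.3.9 (b)) gives representatives `π ↪ i_G(θ₁)`, `θ₁ ∈ {χ, wχ}`, and `π′ ↪ i_G(θ₂)`, `θ₂ ∈ {χ′, wχ′}`; `π ≅ π′`
(same class), so `θ₂` is an EXPONENT of `π` (Frobenius, ★ CUSP-SUPPORT §1); by LEFT EXACTNESS of the Jacquet functor (★ `jacquetMap_injective`, the unipotent radical
being a union of compact open subgroups ★ `isLimitOfCompactOpen_cmUnipotentU`) `θ₂` is an exponent of `i_G(θ₁)` (★ `HasJacquetExponent.map_of_injective`), whose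
exponents are `θ₁` and `wθ₁` by the rank-one geometric lemma ★ N1 (Casselman L. 7.1.1 (a): `r_B i_G(θ)` has a `T`-stable line with character `wθ` and quotient
character `θ`; ★ `HasJacquetExponent.eq_or_eq_of_line`).  Hence `θ₂ ∈ {χ, wχ}` (`w² = 1`, ★ `conjInvChar_conjInvChar`), i.e. `{χ′, wχ′} ∩ {χ, wχ} ≠ ∅`, and since
`i_G(ψ)` and `i_G(wψ)` have the same constituents (★ K1w) so do `i_G(χ)` and `i_G(χ′)`: **`isConstituentOf_iff_of_common_constituent`**.

* §1 `hasJacquetExponent_cmPrincipalSeries_eq_or` — the exponents of `i_G(χ₁, χ₂)` are `wχ` or `χ` (★ N1 + ★ `eq_or_eq_of_line`).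
* §2 `exponent_mem_orbit_of_isConstituentOf` — a representative of a constituent of `i_G(χ)` embedding into some `i_G(θ₂)` has `θ₂ ∈ {wχ, χ}` … packaged as:
  every exponent `ψ` of (a representative of) a constituent of `i_G(χ)` obtained from an embedding `≅ ↪ i_G(ψ)` lies in `{χ, wχ}`.
* §3 THE HEAD `isConstituentOf_iff_of_common_constituent`.

## References
* [Rogawski1990] J. D. Rogawski, *Automorphic Representations of Unitary Groups in Three Variables*, Ann. of Math. Stud. 123 (1990): §12.2 p. 173.
* [BernsteinZelevinsky1977] I. N. Bernstein, A. V. Zelevinsky, *Induced representations of reductive p-adic groups I*, Ann. Sci. ÉNS 10 (1977): Prop. 1.9 (a), §2.3,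
  Thm. 2.9.
* [Casselman1995] W. Casselman, *Introduction to the theory of admissible representations of p-adic reductive groups* (1974∕1995): Prop. 3.2.3, §4.4 p. 45,
  Cor. 6.3.9 (b) p. 60, L. 7.1.1 (a) p. 67.
-/

set_option autoImplicit false
-- the mandated namespace has the single-problem summit's repeated segment (`HodgeConjecture.HodgeConjecture`)
set_option linter.dupNamespace false

noncomputable section

open NumberField IsDedekindDomain MeasureTheory
open scoped Matrix

open Literature.NumberTheory.Rogawski1990 Literature.NumberTheory.Automorphic Literature.NumberTheory.Automorphic.UnitaryGroup

namespace Summit.HodgeConjecture.HodgeConjecture.Cruxes.H413.F0P3cStCharTSOrbit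

variable (L : Type) [Field L] [NumberField L] [IsCMField L] (v : HeightOneSpectrum (𝓞 ↥(maximalRealSubfield L)))

/-! ## §1 The exponents of a principal series are `wχ` or `χ` -/

set_option synthInstance.maxHeartbeats 400000 in
set_option maxHeartbeats 8000000 in
-- statement∕proof-heavy: `cmPrincipalSeries` carrier and its Jacquet module (class of ★ KeysLabelledPair)
/-- **Every (normalised) exponent of `i_G(χ₁, χ₂)` is `wχ` or `χ`** (continuous pair, `v` non-split): ★ N1's line data (`r_B i_G(χ)` has a stable line with character
`wχ` and quotient character `χ`) read through ★ `HasJacquetExponent.eq_or_eq_of_line`. [cite: Casselman1995, L. 7.1.1 (a) p. 67; Prop. 6.4.1] -/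
theorem hasJacquetExponent_cmPrincipalSeries_eq_or (hns : ∀ w : PlacesOver L v, IsCMField.complexConj L • w.1 = w.1)
    (χ₁ : (LocalRing L v)ˣ →* ℂˣ) (χ₂ : ↥(normOneUnits (conjLocal L (IsCMField.complexConj L) v)) →* ℂˣ)
    (hc1 : Continuous (fun x => ((χ₁ x : ℂˣ) : ℂ))) (hc2 : Continuous (fun x => ((χ₂ x : ℂˣ) : ℂ)))
    (ψ : ↥(torusU (conjLocal L (IsCMField.complexConj L) v) (cmLocalForm L 3 v)) →* ℂˣ)
    (hψ : haveI := locallyCompactSpace_cmBorelU L 3 v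
      (cmPrincipalSeries L 3 v (cmTorusCharPair L v χ₁ χ₂)).HasJacquetExponent (cmBorelTriple L 3 v) ψ) :
    ψ = cmWeylTorusCharPair L v χ₁ χ₂ ∨ ψ = cmTorusCharPair L v χ₁ χ₂ := by
  haveI := locallyCompactSpace_cmBorelU L 3 v
  obtain ⟨-, -, ℓ, -, hℓ, hq⟩ :=
    F0P3U3PrincipalSeriesJacquetFiltrationHolds.U3PrincipalSeriesJacquetFiltration_holds L v hns χ₁ χ₂ hc1 hc2
  exact Representation.HasJacquetExponent.eq_or_eq_of_line (cmBorelTriple L 3 v) ℓ hℓ hq hψ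

/-! ## §2 An exponent coming from an embedding of (a representative of) a constituent lies in the orbit -/

set_option synthInstance.maxHeartbeats 400000 in
set_option maxHeartbeats 8000000 in
-- statement∕proof-heavy (as §1)
/-- **If `⟦π⟧` is a constituent of `i_G(χ₁, χ₂)` and `π ≅ π′ ↪ i_G(ψ)`, then `ψ ∈ {χ, wχ}`.**  ★ N2 embeds a representative `π₀ ≅ π` into `i_G(θ₁)`, `θ₁ ∈ {χ, wχ}`;
`ψ` is an exponent of `π₀` (★ CUSP-SUPPORT §1 along `π₀ ≅ π ≅ π′`); left exactness of the Jacquet functor (★ `jacquetMap_injective` with ★ `isLimitOfCompactOpen_cmUnipotentU`,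
★ `isSmooth_cmPrincipalSeries`) makes it an exponent of `i_G(θ₁)` (★ `HasJacquetExponent.map_of_injective`); §1 at `θ₁` and `w² = 1` (★ `conjInvChar_conjInvChar`).
[cite: BernsteinZelevinsky1977, Prop. 1.9 (a), §2.3] [cite: Casselman1995, Cor. 6.3.9 (b); L. 7.1.1 (a)] -/
theorem eq_or_weyl_of_isConstituentOf_of_injective (hns : ∀ w : PlacesOver L v, IsCMField.complexConj L • w.1 = w.1)
    (χ₁ : (LocalRing L v)ˣ →* ℂˣ) (χ₂ : ↥(normOneUnits (conjLocal L (IsCMField.complexConj L) v)) →* ℂˣ)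
    (hc1 : Continuous (fun x => ((χ₁ x : ℂˣ) : ℂ))) (hc2 : Continuous (fun x => ((χ₂ x : ℂˣ) : ℂ)))
    (c : IrrClass ↥(unitaryGroupOfForm (conjLocal L (IsCMField.complexConj L) v) (cmLocalForm L 3 v)))
    (hc : c.IsConstituentOf (cmPrincipalSeries L 3 v (cmTorusCharPair L v χ₁ χ₂)))
    (r r' : SmoothIrrep ↥(unitaryGroupOfForm (conjLocal L (IsCMField.complexConj L) v) (cmLocalForm L 3 v)))
    (hr : IrrClass.mk r = c) (e : r.ρ.Equiv r'.ρ)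
    (ψ : ↥(torusU (conjLocal L (IsCMField.complexConj L) v) (cmLocalForm L 3 v)) →* ℂˣ)
    (f : r'.ρ.IntertwiningMap (cmPrincipalSeries L 3 v ψ)) (hf : Function.Injective f) :
    ψ = cmTorusCharPair L v χ₁ χ₂ ∨ ψ = cmWeylTorusCharPair L v χ₁ χ₂ := by
  haveI := locallyCompactSpace_cmBorelU L 3 v
  -- N2: a representative `r₀` of `c` embeds into `i_G(χ)` or `i_G(wχ)`
  obtain ⟨r₀, hr₀c, hemb⟩ := F0P3U3ConstituentEmbedsOfJacquet.u3PrincipalSeriesConstituentEmbeds_of_jacquetFiltration L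
    (F0P3U3PrincipalSeriesJacquetFiltrationHolds.U3PrincipalSeriesJacquetFiltration_holds L) v hns χ₁ χ₂ hc1 hc2 c hc
  -- `r₀ ≅ r ≅ r′`, so `ψ` is an exponent of `r₀`
  obtain ⟨e₀⟩ := (IrrClass.mk_eq_mk_iff r₀ r).1 (hr₀c.trans hr.symm)
  have hψ : r₀.ρ.HasJacquetExponent (cmBorelTriple L 3 v) ψ :=
    F0P3cStCharTSCuspSupport.hasJacquetExponent_of_injective_comp_equiv L v hns r₀ r' (e₀.trans e) ψ f hf
  -- push the exponent into `i_G(θ₁)` by left exactness, then read it off N1's line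
  have hN := F0P3UnipotentLimitCompactOpen.isLimitOfCompactOpen_cmUnipotentU L v
  have hw : conjInvChar (conjLocal L (IsCMField.complexConj L) v) (conjInvChar (conjLocal L (IsCMField.complexConj L) v) χ₁) = χ₁ :=
    F0P2pTorusPairsAndVacuity.conjInvChar_conjInvChar (conjLocal L (IsCMField.complexConj L) v) (conjLocal_conjLocal_cm L v) χ₁
  rcases hemb with ⟨f₁, hf₁⟩ | ⟨f₁, hf₁⟩
  · -- `r₀ ↪ i_G(χ)`
    have hψ' : (cmPrincipalSeries L 3 v (cmTorusCharPair L v χ₁ χ₂)).HasJacquetExponent (cmBorelTriple L 3 v) ψ :=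
      Representation.HasJacquetExponent.map_of_injective (cmBorelTriple L 3 v) hψ f₁
        (Representation.jacquetMap_injective (cmBorelTriple L 3 v) hN
          (F0P2pCmPrincipalSeriesInterface.isSmooth_cmPrincipalSeries L v _) f₁ hf₁)
    rcases hasJacquetExponent_cmPrincipalSeries_eq_or L v hns χ₁ χ₂ hc1 hc2 ψ hψ' with h | h
    · exact Or.inr h
    · exact Or.inl h
  · -- `r₀ ↪ i_G(wχ) = i_G(χ̄₁⁻¹, χ₂)`
    have hcw := F0P2pTorusPairsAndVacuity.continuous_coe_conjInvChar (conjLocal L (IsCMField.complexConj L) v)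
      (continuous_conjLocal L (IsCMField.complexConj L) v) χ₁ hc1
    have hψ' : (cmPrincipalSeries L 3 v (cmTorusCharPair L v (conjInvChar (conjLocal L (IsCMField.complexConj L) v) χ₁) χ₂)).HasJacquetExponent
        (cmBorelTriple L 3 v) ψ :=
      Representation.HasJacquetExponent.map_of_injective (cmBorelTriple L 3 v) hψ f₁
        (Representation.jacquetMap_injective (cmBorelTriple L 3 v) hN
          (F0P2pCmPrincipalSeriesInterface.isSmooth_cmPrincipalSeries L v _) f₁ hf₁)
    rcases hasJacquetExponent_cmPrincipalSeries_eq_or L v hns _ χ₂ hcw hc2 ψ hψ' with h | h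
    · -- `ψ = w(wχ) = χ`
      left
      rw [h, cmWeylTorusCharPair_eq, hw]
    · exact Or.inr h

/-! ## §3 THE HEAD — a common constituent forces equal constituent sets -/

set_option synthInstance.maxHeartbeats 400000 in
set_option maxHeartbeats 8000000 in
-- statement∕proof-heavy (as §1)
/-- **«ORBIT★» — two principal series of `U(Φ₃)(L⁺_v)` with a COMMON constituent have the SAME constituents** (`v` non-split; continuous pairs `(χ₁, χ₂)`,
`(χ′₁, χ′₂)`).  ★ N2 at `χ′` gives `π′ ↪ i_G(θ₂)`, `θ₂ ∈ {χ′, wχ′}`; §2 gives `θ₂ ∈ {χ, wχ}`; ★ K1w («`i_G(ψ)`, `i_G(wψ)` have the same constituents») at `χ` and at `χ′`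
closes the square. [cite: Rogawski1990, §12.2 p. 173] [cite: BernsteinZelevinsky1977, Thm. 2.9] [cite: Casselman1995, Cor. 6.3.9 (b); L. 7.1.1 (a)] -/
theorem isConstituentOf_iff_of_common_constituent (hns : ∀ w : PlacesOver L v, IsCMField.complexConj L • w.1 = w.1)
    (χ₁ : (LocalRing L v)ˣ →* ℂˣ) (χ₂ : ↥(normOneUnits (conjLocal L (IsCMField.complexConj L) v)) →* ℂˣ)
    (hc1 : Continuous (fun x => ((χ₁ x : ℂˣ) : ℂ))) (hc2 : Continuous (fun x => ((χ₂ x : ℂˣ) : ℂ)))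
    (χ₁' : (LocalRing L v)ˣ →* ℂˣ) (χ₂' : ↥(normOneUnits (conjLocal L (IsCMField.complexConj L) v)) →* ℂˣ)
    (hc1' : Continuous (fun x => ((χ₁' x : ℂˣ) : ℂ))) (hc2' : Continuous (fun x => ((χ₂' x : ℂˣ) : ℂ)))
    (c : IrrClass (Gqs L v))
    (hc : c.IsConstituentOf (cmPrincipalSeries L 3 v (cmTorusCharPair L v χ₁ χ₂)))
    (hc' : c.IsConstituentOf (cmPrincipalSeries L 3 v (cmTorusCharPair L v χ₁' χ₂')))
    (d : IrrClass (Gqs L v)) :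
    d.IsConstituentOf (cmPrincipalSeries L 3 v (cmTorusCharPair L v χ₁' χ₂')) ↔
      d.IsConstituentOf (cmPrincipalSeries L 3 v (cmTorusCharPair L v χ₁ χ₂)) := by
  haveI := locallyCompactSpace_cmBorelU L 3 v
  -- N2 at `χ′`: a representative `r′` of `c` embeds into `i_G(χ′)` or `i_G(wχ′)`
  obtain ⟨r', hr'c, hemb'⟩ := F0P3U3ConstituentEmbedsOfJacquet.u3PrincipalSeriesConstituentEmbeds_of_jacquetFiltration L
    (F0P3U3PrincipalSeriesJacquetFiltrationHolds.U3PrincipalSeriesJacquetFiltration_holds L) v hns χ₁' χ₂' hc1' hc2' c hc'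
  have hw' : cmWeylTorusCharPair L v χ₁' χ₂' = cmTorusCharPair L v (conjInvChar (conjLocal L (IsCMField.complexConj L) v) χ₁') χ₂' := rfl
  have hw : cmWeylTorusCharPair L v χ₁ χ₂ = cmTorusCharPair L v (conjInvChar (conjLocal L (IsCMField.complexConj L) v) χ₁) χ₂ := rfl
  -- the embedding target `θ₂ ∈ {χ′, wχ′}` lies in `{χ, wχ}`: four cases, each closed by K1w and transport along the character equality
  rcases hemb' with ⟨f, hf⟩ | ⟨f, hf⟩
  · rcases eq_or_weyl_of_isConstituentOf_of_injective L v hns χ₁ χ₂ hc1 hc2 c hc r' r' hr'c (Representation.Equiv.refl _) _ f hf with h | h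
    · -- `χ′ = χ`
      exact F0P3cStCharTSPs2Kind3.isConstituentOf_iff_of_eq L v h d
    · -- `χ′ = wχ`
      exact (F0P3cStCharTSPs2Kind3.isConstituentOf_iff_of_eq L v (h.trans hw) d).trans
        (F0P3cStCharTSPs2Kind3.isConstituentOf_iff_weyl L v hns χ₁ χ₂ d).symm
  · rcases eq_or_weyl_of_isConstituentOf_of_injective L v hns χ₁ χ₂ hc1 hc2 c hc r' r' hr'c (Representation.Equiv.refl _) _ f hf with h | h
    · -- `wχ′ = χ`
      exact (F0P3cStCharTSPs2Kind3.isConstituentOf_iff_weyl L v hns χ₁' χ₂' d).trans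
        (F0P3cStCharTSPs2Kind3.isConstituentOf_iff_of_eq L v (hw'.symm.trans h) d)
    · -- `wχ′ = wχ`
      exact ((F0P3cStCharTSPs2Kind3.isConstituentOf_iff_weyl L v hns χ₁' χ₂' d).trans
        (F0P3cStCharTSPs2Kind3.isConstituentOf_iff_of_eq L v (hw'.symm.trans (h.trans hw)) d)).trans
        (F0P3cStCharTSPs2Kind3.isConstituentOf_iff_weyl L v hns χ₁ χ₂ d).symm

end Summit.HodgeConjecture.HodgeConjecture.Cruxes.H413.F0P3cStCharTSOrbit

end
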